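import Summits.CriticalPhenomena.Ising3DConformalLimit.Theorems.RotationJoining.Negative.Defs

/-!
# `RotationJoining` (crux stmt-CriticalPhenomena-18763), negative-side support, module 1:
# the Σ3 lattice geometry of the crux's cells (coordinates made explicit for `omega`)

Membership lemmas for `box`, `rotCell`, `rotCell₀`, `axisCell`, `axisCell₀`; the `u = 0` blocks
are the normalising cells (`rotCell_zero`, `axisCell_zero`); and the COMMENSURABILITY fact used by
the counter-measure of `RotationJoiningFalseWithoutGibbs`: for `n = 3k` the rotated cell of index
`e₀` is the lattice translate of the reference rotated cell by `tvec k = k·Aᵀe₀ = (2k, 2k, −k)`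
(`rotCell_e0_eq_map`), the axis cell of index `e₀` is the translate of `[0,n)³` by `n e₀`
(`axisCell_e0_eq_map`), and the third coordinate on the reference rotated cell lies in
`[−k+1, 4k−1]` (`layer_bounds_of_mem_rotCell₀`, from `9x₂ = −(Ax)₀ + 2(Ax)₁ + 2(Ax)₂`).
(Background, checked numerically only: `ψ(x) = ⌊Ax/3⌋` is a bijection of `ℤ³` within
sup-distance `< 1` of `T = A/3`, so every rotated cell has exactly `n³` points — Kozma's
commensurate-rotation device.)

Refuter cdisprove seat (cycle 1); nothing here refutes the crux.
-/

namespace Summit.CriticalPhenomena.Ising3DConformalLimit.Theorems.RotationJoining.Negative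

open MeasureTheory Finset
open Literature.Probability.LatticeModels

noncomputable section

/-- Row `0` of `A x`. -/
@[simp] theorem A_mulVec_zero (x : Fin 3 → ℤ) : Matrix.mulVec A x 0 = 2 * x 0 + 2 * x 1 - x 2 := by
  simp [A, Matrix.mulVec, dotProduct, Fin.sum_univ_three]; ring

/-- Row `1` of `A x`. -/
@[simp] theorem A_mulVec_one (x : Fin 3 → ℤ) : Matrix.mulVec A x 1 = -x 0 + 2 * x 1 + 2 * x 2 := by
  simp [A, Matrix.mulVec, dotProduct, Fin.sum_univ_three]

/-- Row `2` of `A x`. -/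
@[simp] theorem A_mulVec_two (x : Fin 3 → ℤ) : Matrix.mulVec A x 2 = 2 * x 0 - x 1 + 2 * x 2 := by
  simp [A, Matrix.mulVec, dotProduct, Fin.sum_univ_three]; ring

/-- Membership in the box, coordinatewise. -/
theorem mem_box_iff {n m : ℕ} {x : Site 3} : x ∈ box n m ↔
    (-(2 * (n:ℤ) * ((m:ℤ) + 1)) ≤ x 0 ∧ x 0 ≤ 2 * (n:ℤ) * ((m:ℤ) + 1)) ∧
    (-(2 * (n:ℤ) * ((m:ℤ) + 1)) ≤ x 1 ∧ x 1 ≤ 2 * (n:ℤ) * ((m:ℤ) + 1)) ∧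
    (-(2 * (n:ℤ) * ((m:ℤ) + 1)) ≤ x 2 ∧ x 2 ≤ 2 * (n:ℤ) * ((m:ℤ) + 1)) := by
  simp only [box, Fintype.mem_piFinset, Finset.mem_Icc]
  exact ⟨fun h => ⟨h 0, h 1, h 2⟩, fun h i => by fin_cases i; exacts [h.1, h.2.1, h.2.2]⟩

/-- Membership in a rotated cell, coordinatewise. -/
theorem mem_rotCell_iff {n m : ℕ} {u : Fin 3 → ℤ} {x : Site 3} : x ∈ rotCell n m u ↔
    x ∈ box n m ∧
    (3 * (n:ℤ) * u 0 ≤ 2 * x 0 + 2 * x 1 - x 2 ∧ 2 * x 0 + 2 * x 1 - x 2 < 3 * (n:ℤ) * (u 0 + 1)) ∧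
    (3 * (n:ℤ) * u 1 ≤ -x 0 + 2 * x 1 + 2 * x 2 ∧ -x 0 + 2 * x 1 + 2 * x 2 < 3 * (n:ℤ) * (u 1 + 1)) ∧
    (3 * (n:ℤ) * u 2 ≤ 2 * x 0 - x 1 + 2 * x 2 ∧ 2 * x 0 - x 1 + 2 * x 2 < 3 * (n:ℤ) * (u 2 + 1)) := by
  simp only [rotCell, Finset.mem_filter]
  refine and_congr_right fun _ => ?_
  rw [← A_mulVec_zero, ← A_mulVec_one, ← A_mulVec_two]
  exact ⟨fun h => ⟨h 0, h 1, h 2⟩, fun h i => by fin_cases i; exacts [h.1, h.2.1, h.2.2]⟩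

/-- Membership in the reference rotated cell, coordinatewise. -/
theorem mem_rotCell₀_iff {n m : ℕ} {x : Site 3} : x ∈ rotCell₀ n m ↔
    x ∈ box n m ∧
    (0 ≤ 2 * x 0 + 2 * x 1 - x 2 ∧ 2 * x 0 + 2 * x 1 - x 2 < 3 * (n:ℤ)) ∧
    (0 ≤ -x 0 + 2 * x 1 + 2 * x 2 ∧ -x 0 + 2 * x 1 + 2 * x 2 < 3 * (n:ℤ)) ∧
    (0 ≤ 2 * x 0 - x 1 + 2 * x 2 ∧ 2 * x 0 - x 1 + 2 * x 2 < 3 * (n:ℤ)) := by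
  simp only [rotCell₀, Finset.mem_filter]
  refine and_congr_right fun _ => ?_
  rw [← A_mulVec_zero, ← A_mulVec_one, ← A_mulVec_two]
  exact ⟨fun h => ⟨h 0, h 1, h 2⟩, fun h i => by fin_cases i; exacts [h.1, h.2.1, h.2.2]⟩

/-- Membership in an axis cell, coordinatewise. -/
theorem mem_axisCell_iff {n : ℕ} {u : Fin 3 → ℤ} {x : Site 3} : x ∈ axisCell n u ↔
    ((n:ℤ) * u 0 ≤ x 0 ∧ x 0 < (n:ℤ) * u 0 + n) ∧ ((n:ℤ) * u 1 ≤ x 1 ∧ x 1 < (n:ℤ) * u 1 + n) ∧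
    ((n:ℤ) * u 2 ≤ x 2 ∧ x 2 < (n:ℤ) * u 2 + n) := by
  simp only [axisCell, Fintype.mem_piFinset, Finset.mem_Ico]
  exact ⟨fun h => ⟨h 0, h 1, h 2⟩, fun h i => by fin_cases i; exacts [h.1, h.2.1, h.2.2]⟩

/-- Membership in the reference axis cell, coordinatewise. -/
theorem mem_axisCell₀_iff {n : ℕ} {x : Site 3} : x ∈ axisCell₀ n ↔
    (0 ≤ x 0 ∧ x 0 < n) ∧ (0 ≤ x 1 ∧ x 1 < n) ∧ (0 ≤ x 2 ∧ x 2 < n) := by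
  simp only [axisCell₀, Fintype.mem_piFinset, Finset.mem_Ico]
  exact ⟨fun h => ⟨h 0, h 1, h 2⟩, fun h i => by fin_cases i; exacts [h.1, h.2.1, h.2.2]⟩

/-- The `u = 0` block of copy 1 is the normalising cell. -/
theorem rotCell_zero (n m : ℕ) : rotCell n m 0 = rotCell₀ n m := by
  ext x; simp only [mem_rotCell_iff, mem_rotCell₀_iff, Pi.zero_apply, mul_zero, zero_add, mul_one]

/-- The `u = 0` block of copy 2 is the normalising cube. -/
theorem axisCell_zero (n : ℕ) : axisCell n 0 = axisCell₀ n := by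
  ext x; simp only [mem_axisCell_iff, mem_axisCell₀_iff, Pi.zero_apply, mul_zero, zero_add]

/-- The origin lies in the reference rotated cell. -/
theorem zero_mem_rotCell₀ {n : ℕ} (m : ℕ) (hn : 1 ≤ n) : (0 : Site 3) ∈ rotCell₀ n m := by
  have h0 : (0:ℤ) ≤ 2 * (n:ℤ) * ((m:ℤ) + 1) := by positivity
  simp only [mem_rotCell₀_iff, mem_box_iff, Pi.zero_apply]
  omega

/-- The block index `e₀ = (1,0,0)` lies in the window `m = 1`. -/
theorem abs_single_le (i : Fin 3) : |(Pi.single 0 1 : Fin 3 → ℤ) i| ≤ (1 : ℕ) := by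
  fin_cases i <;> simp

/-- Commensurability at work: for `n = 3k` the rotated cell of index `e₀` is the lattice translate
of the reference rotated cell by `tvec k` (both inside the window-`1` box). -/
theorem rotCell_e0_eq_map (k : ℕ) :
    rotCell (3 * k) 1 (Pi.single 0 1) = (rotCell₀ (3 * k) 1).map (addRightEmbedding (tvec k)) := by
  ext x
  simp only [Finset.mem_map, addRightEmbedding_apply, mem_rotCell_iff, mem_rotCell₀_iff, mem_box_iff,
    Pi.single_eq_same, Pi.single_eq_of_ne (by decide : (1 : Fin 3) ≠ 0),
    Pi.single_eq_of_ne (by decide : (2 : Fin 3) ≠ 0)]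
  push_cast
  constructor
  · rintro h
    refine ⟨x - tvec k, ?_, ?_⟩
    · simp only [Pi.sub_apply, tvec_zero, tvec_one, tvec_two]
      omega
    · ext i; fin_cases i <;> simp
  · rintro ⟨y, hy, rfl⟩
    simp only [Pi.add_apply, tvec_zero, tvec_one, tvec_two]
    omega

/-- The axis cell of index `e₀` is the translate of the reference cube by `n e₀`. -/
theorem axisCell_e0_eq_map (n : ℕ) :
    axisCell n (Pi.single 0 1) = (axisCell₀ n).map (addRightEmbedding (Pi.single 0 (n:ℤ))) := by
  ext x
  simp only [Finset.mem_map, addRightEmbedding_apply, mem_axisCell_iff, mem_axisCell₀_iff,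
    Pi.single_eq_same, Pi.single_eq_of_ne (by decide : (1 : Fin 3) ≠ 0),
    Pi.single_eq_of_ne (by decide : (2 : Fin 3) ≠ 0)]
  constructor
  · rintro h
    refine ⟨x - Pi.single 0 (n:ℤ), ?_, ?_⟩
    · simp only [Pi.sub_apply, Pi.single_eq_same, Pi.single_eq_of_ne (by decide : (1 : Fin 3) ≠ 0),
        Pi.single_eq_of_ne (by decide : (2 : Fin 3) ≠ 0)]
      omega
    · ext i; fin_cases i <;> simp
  · rintro ⟨y, hy, rfl⟩
    simp only [Pi.add_apply, Pi.single_eq_same, Pi.single_eq_of_ne (by decide : (1 : Fin 3) ≠ 0),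
        Pi.single_eq_of_ne (by decide : (2 : Fin 3) ≠ 0)]
    omega

/-- The third coordinate on the reference rotated cell at `n = 3k` lies in `[-k+1, 4k-1]`
(`9 x₂ = -(Ax)₀ + 2(Ax)₁ + 2(Ax)₂`). -/
theorem layer_bounds_of_mem_rotCell₀ {k : ℕ} {x : Site 3} (hx : x ∈ rotCell₀ (3 * k) 1) :
    -(k:ℤ) + 1 ≤ x 2 ∧ x 2 ≤ 4 * (k:ℤ) - 1 := by
  simp only [mem_rotCell₀_iff, mem_box_iff] at hx
  push_cast at hx
  omega

end

end Summit.CriticalPhenomena.Ising3DConformalLimit.Theorems.RotationJoining.Negative
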